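import Literature.MathematicalPhysics.QuantumLattice.KomaPiFluxZ2System
import Literature.MathematicalPhysics.QuantumLattice.KomaTasakiGriffithsTheoremSubsequence
import Literature.MathematicalPhysics.QuantumLattice.KomaPiFluxSpontaneousOrder
import HarnessLib

/-!
# Spontaneous superconducting order AT POSITIVE TEMPERATURE in Koma's `π`-flux BCS lattice-fermion
# model: Koma 2022 Theorem 2.1 (thermal long-range order, `D ≥ 3`, `β ≥ β_c`) ⟹ by Koma–Tasaki 1993
# Theorem 2.1 (Griffiths' theorem for non-commuting order operators, hypothesis i) removed) the sourced
# order parameter obeys `|Λ|⁻¹ ⟨O^{(Λ)}⟩_{β,B} ≥ 1/50` for EVERY field `B > 0` on all large even tori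

T. Koma, *Nambu–Goldstone modes for superconducting lattice fermions*, arXiv:2201.13135 (2022) [Koma2022],
Theorem 2.1 (p. 5): for `d ≥ 3`, `|κ|/g ≤ κ̂`, `g'/g ≤ ĝ'`, `β ≥ β_c` the long-range order
`m_LRO = lim_Λ |Λ|⁻¹√⟨[O^{(Λ)}]²⟩_{β,0} > 0` — in the tree `KomaPiFlux.superconductingOrder_coulomb_abs` /
`printed_superconductingOrder_coulomb` (`κ̂ = 1/1000`, `ĝ' = 1/2000`, `m^{(Λ)}_LRO ≥ 1/50` on all tori of side
`2k ≥ 2k₀`).  Koma draws the consequence for the order parameter only at zero temperature ((2.13)–(2.15), the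
tree's `KomaPiFluxSpontaneousOrder.lean` / `KomaPiFluxInfiniteVolumeOrder.lean`, via [33] = KT93 Theorem 7.3).
The POSITIVE-TEMPERATURE consequence is Koma–Tasaki 1993 THEOREM 2.1 [KomaTasaki1993, (2.13)]:
`m_s ≥ lim_Λ (N^{-2}⟨O_Λ²⟩_Λ(0))^{1/2} = σ = m_LRO` at every `β`, for `ℤ₂` systems with hypotheses i)–iii) —
proved in the tree (`KomaTasaki.kt93_theorem_2_1_holds`) and freed of hypothesis i) (existence of the
thermodynamic limit of the free energy) in `KomaTasakiGriffithsTheoremSubsequence.lean`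
(`KomaTasaki.Z2System.le_magnetisation_add_of_eventually_moment_one`: eventual LRO along the full sequence
⟹ for every `B > 0`, `ε > 0`, eventually `N⁻¹⟨O⟩(B) ≥ σ - ε`).  Koma's model IS such a `ℤ₂` system
(`KomaPiFlux.z2System`, `KomaPiFluxZ2System.lean`: `h_x` Koma's local terms, `o_x = Γ²_x`, `U_Λ = e^{i(π/2)N̂}`,
`N⁻²⟨O²⟩(0) = lroSq`, `log dim = 2|Λ| log 2`).  This file assembles:

* ENGINE **`thermal_orderParameter_ge_of_lroSq`**: for fixed `κ, U, g, g'`, `β > 0`: if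
  `a ≤ lroSq β H(κ,U;g,g';0;0)` on all tori of side `2k ≥ 2k₀` (`0 ≤ a`), then for every `B > 0`, `ε > 0` there
  is `k₁` with `√a - ε ≤ |Λ|⁻¹ Re⟨Σ_xΓ²_x⟩_{β, H(κ,U;g,g';0;B)}` for all `k ≥ k₁` (Lieb frame);
* **`thermal_spontaneousOrder_coulomb`** (Lieb frame) — `D = d+1 ≥ 3`, `g > 0`, `|κ| ≤ g/1000`,
  `0 ≤ g' ≤ g/2000`, `U + 2gD ≤ 0`: there is `β₀ > 0` such that for every `β ≥ β₀` and every field `B > 0`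
  there is `k₁` with **`1/50 ≤ |Λ|⁻¹ Re⟨Σ_xΓ²_x⟩_{β, H(B)}`** on every torus `(ℤ/2kℤ)^D`, `k ≥ k₁`
  (`σ = 1/√2000 > 1/50` absorbs the `ε`); the `ε`-form with the sharp constant `1/√2000 - ε`
  (`thermal_spontaneousOrder_coulomb_eps`);
* the `U(1)` factor `√2` (KT93 Remark after Theorem 6.1, the tree's `Z2System.kt93_corollary_2_2_u1` freed of
  hypothesis i) in `KomaTasakiGriffithsTheoremSubsequence.lean`; second component `O^{(2)} = Σ_xΓ¹_x`, generator
  `C = N̂/2`, `[C, Σ_xΓ¹_x] = -iΣ_xΓ²_x`, `[C, Σ_xΓ²_x] = iΣ_xΓ¹_x`, `‖[Σ_xΓ¹_x, Σ_xΓ²_x]‖ ≤ 8|Λ|` from the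
  `U1System` instance `ktSystem`): **`thermal_spontaneousOrder_coulomb_sqrtTwo`** (`1/√1000 - ε`, the constant
  `μ` of the tree's zero-temperature (2.15)) and the `ε`-free **`thermal_spontaneousOrder_coulomb_sharp`** /
  **`printed_thermal_spontaneousOrder_coulomb_sharp`** (`3/100`);
* **`printed_thermal_spontaneousOrder_coulomb`** — the same in Koma's own frame: the Hamiltonian (2.4) with
  the antiperiodic `π`-flux hopping (2.7)–(2.9), the interaction (2.6) (BCS pair term `g`, Coulomb `g'`) and the
  source `-B·O^{(Λ)}` with the staggered order parameter (2.5): for `d+1 ≥ 3`, `g > 0`, `|κ| ≤ g/1000`,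
  `0 ≤ g' ≤ g/2000`, `β ≥ β₀`, every `B > 0`: `|Λ|⁻¹⟨O^{(Λ)}⟩^{(Λ)}_{β,B} ≥ 1/50` on all large even tori —
  i.e. `liminf_{Λ↗ℤ^D} |Λ|⁻¹⟨O^{(Λ)}⟩_{β,B} ≥ 1/50` for every `B > 0`, so the spontaneous order parameter
  `m_s(β) = lim_{B↓0} lim_Λ |Λ|⁻¹⟨O^{(Λ)}⟩_{β,B}` of KT93 (2.11) is `≥ 1/50 > 0` along every convergent
  choice of the limits: SPONTANEOUS SUPERCONDUCTING ORDER AT POSITIVE TEMPERATURE in `D ≥ 3`.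

Faithfulness / what is NOT claimed.  Koma's Theorem 2.1 is the LRO statement at `β ≥ β_c`; KT93 Theorem 2.1
is printed for general `ℤ₂` systems under hypothesis i), which is removed here by the subsequence argument of
`KomaTasakiGriffithsTheoremSubsequence.lean` (KT93 p. 196: "one can always take a subsequence") — the
combination "Koma 2022 Thm 2.1 + KT93 Thm 2.1 ⟹ `m_s(β) > 0`" is a corollary of the two printed theorems,
stated by neither paper in this form (Koma prints the `T = 0` version (2.15) only).  The `U(1)` improvement
`m_s ≥ √2 σ` is KT93's Remark after Theorem 6.1 ("the models with an `SO(2) = U(1)` invariance, where we get a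
factor `√2` … the electron pair condensation problems in lattice electron systems"), proved in the tree as
`Z2System.kt93_corollary_2_2_u1`.  Sibling-model statement (Koma's `π`-flux BCS model), NOT a statement about the
Hubbard model.  Everything is PROVED; no definition, no named fact.

## References

* [Koma2022] T. Koma, arXiv:2201.13135, §2 (2.4)–(2.12), Theorem 2.1; (2.13)–(2.15).
* [KomaTasaki1993] T. Koma, H. Tasaki, Commun. Math. Phys. 158 (1993) 191–214, §2 (2.6)–(2.13), Theorem 2.1;
  p. 196; p. 211 (application to "the electron pair condensation problems in lattice electron systems").
* [DysonLiebSimon1978] F. J. Dyson, E. H. Lieb, B. Simon, J. Stat. Phys. 18 (1978) 335, Thm. 1.2.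
-/

noncomputable section

namespace Literature.MathematicalPhysics.QuantumLattice

open _root_.Matrix Finset Filter Topology HubbardWave0 PairHopRP FermionTorus LiebCutRP
open Literature.Probability.LatticeModels
open scoped Matrix.Norms.L2Operator ComplexConjugate ComplexOrder

namespace KomaPiFlux

attribute [local instance] LiebCutRP.decEqTorus

variable {d : ℕ}

open KT

/-! ### The engine: thermal LRO on the large even tori ⟹ sourced order parameter at every `B > 0` -/

/-- `1/50 < 1/√2000` (so the `ε` of KT93 is absorbed: `σ = √(1/2000)`). [cite: Koma2022, Theorem 2.1] -/
theorem one_div_fifty_lt_sqrt : (1 / 50 : ℝ) < Real.sqrt (1 / 2000) := by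
  rw [show (1 / 50 : ℝ) = Real.sqrt ((1 / 50) ^ 2) by rw [Real.sqrt_sq (by norm_num)]]
  exact Real.sqrt_lt_sqrt (by norm_num) (by norm_num)

/-- **ENGINE (Lieb frame, every `β > 0`).**  If the symmetric Gibbs states of `H = H(κ,U;g,g';0;0)` carry
long-range order `a ≤ lroSq β H` (`0 ≤ a`) on every torus `(ℤ/2kℤ)^{d+1}` with `k ≥ k₀`, then for every field
`B > 0` and every `ε > 0` there is `k₁` such that for all `k ≥ k₁`:
`√a - ε ≤ |Λ|⁻¹ Re⟨Σ_xΓ²_x⟩_{β, H(κ,U;g,g';0;B)}` — KT93 Theorem 2.1 (`k = 1`, hypothesis i) removed) for the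
`ℤ₂` system `KomaPiFlux.z2System`. [cite: KomaTasaki1993, Theorem 2.1 (2.13), (2.11)–(2.12)] [cite: Koma2022, (2.10)–(2.11)] -/
theorem thermal_orderParameter_ge_of_lroSq {κ U g g' β a : ℝ} (hβ : 0 < β) (ha : 0 ≤ a) {k₀ : ℕ}
    (hLRO : ∀ k : ℕ, k₀ ≤ k → ∀ [NeZero (2 * k)],
      a ≤ lroSq β (hamiltonianC κ U g g' (fun (_ _ : FermionTorus (d + 1) (2 * k)) => (0 : ℝ)) 0))
    {B : ℝ} (hB : 0 < B) {ε : ℝ} (hε : 0 < ε) :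
    ∃ k₁ : ℕ, ∀ k : ℕ, k₁ ≤ k → ∀ [NeZero (2 * k)],
      Real.sqrt a - ε ≤ (Fintype.card (FermionTorus (d + 1) (2 * k)) : ℝ)⁻¹ *
        (gibbsState β (hamiltonianC κ U g g' (fun (_ _ : FermionTorus (d + 1) (2 * k)) => (0 : ℝ)) B)
          orderParameter).re := by
  -- the sequence of `ℤ₂` systems on the tori of side `2(j+1)`
  have hne : ∀ j : ℕ, NeZero (2 * (j + 1)) := fun j => ⟨by omega⟩
  let sys : (j : ℕ) → KomaTasaki.Z2System (Fintype.card (FermionTorus (d + 1) (2 * (j + 1))))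
      (hbarConst d κ U g g') 2 (2 * (d + 1) + 1) (Idx d (2 * (j + 1))) :=
    fun j => @z2System d (2 * (j + 1)) (hne j) κ U g g'
  have hN : Tendsto (fun j : ℕ => Fintype.card (FermionTorus (d + 1) (2 * (j + 1)))) atTop atTop :=
    tendsto_card_fermionTorus_two_mul.comp (tendsto_add_atTop_nat 1)
  have hdim : ∀ j : ℕ, Real.log (Fintype.card (Idx d (2 * (j + 1)))) ≤
      2 * (Fintype.card (FermionTorus (d + 1) (2 * (j + 1))) : ℝ) := fun j => log_card_idx_le
  -- eventual LRO in KT93 normalisation: `(√a)² ≤ moment β 1`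
  have hLRO' : ∀ᶠ j : ℕ in atTop, (Real.sqrt a) ^ 2 ≤ (sys j).moment β 1 := by
    filter_upwards [eventually_ge_atTop k₀] with j hj
    rw [Real.sq_sqrt ha, @z2System_moment_one d (2 * (j + 1)) (hne j)]
    exact @hLRO (j + 1) (by omega) (hne j)
  have hev := KomaTasaki.Z2System.le_magnetisation_add_of_eventually_moment_one sys (by norm_num : (0 : ℝ) ≤ 2)
    hβ hN hdim (Real.sqrt_nonneg a) hLRO' hB hε
  obtain ⟨j₁, hj₁⟩ := eventually_atTop.1 hev
  refine ⟨j₁ + 1, fun k hk inst => ?_⟩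
  obtain ⟨j, rfl⟩ : ∃ j, k = j + 1 := ⟨k - 1, by omega⟩
  have h := hj₁ j (by omega)
  rw [@z2System_magnetisation d (2 * (j + 1)) (hne j)] at h
  have hinst : inst = hne j := rfl
  subst hinst
  linarith

/-! ### Koma's model, Lieb frame: spontaneous superconducting order at `β ≥ β₀` -/

/-- **THERMAL SPONTANEOUS SUPERCONDUCTING ORDER, `ε`-form (Lieb frame).**  For `D = d+1 ≥ 3`, `g > 0`,
`|κ| ≤ g/1000`, `0 ≤ g' ≤ g/2000`, `U + 2gD ≤ 0` there is `β₀ > 0` (that of the tree's Theorem 2.1) such that for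
every `β ≥ β₀`, every field `B > 0` and every `ε > 0` there is `k₁` with
`1/√2000 - ε ≤ |Λ|⁻¹ Re⟨Σ_xΓ²_x⟩_{β, H(κ,U;g,g';0;B)}` on every torus `(ℤ/2kℤ)^D`, `k ≥ k₁`
(`σ² = 1/2000` is the long-range order of `superconductingOrder_coulomb_abs`).
[cite: Koma2022, Theorem 2.1, (2.10)–(2.12)] [cite: KomaTasaki1993, Theorem 2.1 (2.13)] -/
theorem thermal_spontaneousOrder_coulomb_eps (hd : 2 ≤ d) {κ U g g' : ℝ} (hg : 0 < g) (hκg : |κ| ≤ g / 1000)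
    (hg'0 : 0 ≤ g') (hg'g : g' ≤ g / 2000) (hU : U + 2 * g * (d + 1) ≤ 0) :
    ∃ β₀ : ℝ, 0 < β₀ ∧ ∀ β : ℝ, β₀ ≤ β → ∀ B : ℝ, 0 < B → ∀ ε : ℝ, 0 < ε →
      ∃ k₁ : ℕ, ∀ k : ℕ, k₁ ≤ k → ∀ [NeZero (2 * k)],
        Real.sqrt (1 / 2000) - ε ≤ (Fintype.card (FermionTorus (d + 1) (2 * k)) : ℝ)⁻¹ *
          (gibbsState β (hamiltonianC κ U g g' (fun (_ _ : FermionTorus (d + 1) (2 * k)) => (0 : ℝ)) B)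
            orderParameter).re := by
  obtain ⟨β₀, k₀, hβ₀, h⟩ := superconductingOrder_coulomb_abs hd hg hκg hg'0 hg'g hU
  refine ⟨β₀, hβ₀, fun β hβ B hB ε hε => ?_⟩
  exact thermal_orderParameter_ge_of_lroSq (lt_of_lt_of_le hβ₀ hβ) (by norm_num) (fun k hk _ => h β hβ k hk) hB hε

/-- **THERMAL SPONTANEOUS SUPERCONDUCTING ORDER IN KOMA'S `π`-FLUX BCS MODEL (Lieb frame).**  For
`D = d+1 ≥ 3`, `g > 0`, `|κ| ≤ g/1000`, `0 ≤ g' ≤ g/2000`, `U + 2gD ≤ 0` there is `β₀ > 0` such that for every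
`β ≥ β₀` and EVERY symmetry-breaking field `B > 0` there is `k₁` with
**`1/50 ≤ |Λ|⁻¹ Re⟨Σ_xΓ²_x⟩_{β, H(κ,U;g,g';0;B)}`** on every torus `(ℤ/2kℤ)^D`, `k ≥ k₁`: the thermal long-range
order of Koma's Theorem 2.1 forces, by Koma–Tasaki 1993 Theorem 2.1 (hypothesis i) removed), a sourced order
parameter bounded below uniformly in the volume and in the field — `liminf_Λ |Λ|⁻¹⟨O⟩_{β,B} ≥ 1/50` for every
`B > 0`, hence `m_s(β) ≥ 1/50`. [cite: Koma2022, Theorem 2.1, (2.10)–(2.12)] [cite: KomaTasaki1993, Theorem 2.1 (2.13), (2.11)] -/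
theorem thermal_spontaneousOrder_coulomb (hd : 2 ≤ d) {κ U g g' : ℝ} (hg : 0 < g) (hκg : |κ| ≤ g / 1000)
    (hg'0 : 0 ≤ g') (hg'g : g' ≤ g / 2000) (hU : U + 2 * g * (d + 1) ≤ 0) :
    ∃ β₀ : ℝ, 0 < β₀ ∧ ∀ β : ℝ, β₀ ≤ β → ∀ B : ℝ, 0 < B →
      ∃ k₁ : ℕ, ∀ k : ℕ, k₁ ≤ k → ∀ [NeZero (2 * k)],
        (1 / 50 : ℝ) ≤ (Fintype.card (FermionTorus (d + 1) (2 * k)) : ℝ)⁻¹ *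
          (gibbsState β (hamiltonianC κ U g g' (fun (_ _ : FermionTorus (d + 1) (2 * k)) => (0 : ℝ)) B)
            orderParameter).re := by
  obtain ⟨β₀, hβ₀, h⟩ := thermal_spontaneousOrder_coulomb_eps hd hg hκg hg'0 hg'g hU
  refine ⟨β₀, hβ₀, fun β hβ B hB => ?_⟩
  obtain ⟨k₁, hk₁⟩ := h β hβ B hB (Real.sqrt (1 / 2000) - 1 / 50) (sub_pos.2 one_div_fifty_lt_sqrt)
  exact ⟨k₁, fun k hk _ => by have := hk₁ k hk; linarith⟩

/-- The `g' = 0` edition (no Coulomb term), Lieb frame. [cite: Koma2022, Theorem 2.1] [cite: KomaTasaki1993, Theorem 2.1 (2.13)] -/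
theorem thermal_spontaneousOrder (hd : 2 ≤ d) {κ U g : ℝ} (hg : 0 < g) (hκg : |κ| ≤ g / 1000)
    (hU : U + 2 * g * (d + 1) ≤ 0) :
    ∃ β₀ : ℝ, 0 < β₀ ∧ ∀ β : ℝ, β₀ ≤ β → ∀ B : ℝ, 0 < B →
      ∃ k₁ : ℕ, ∀ k : ℕ, k₁ ≤ k → ∀ [NeZero (2 * k)],
        (1 / 50 : ℝ) ≤ (Fintype.card (FermionTorus (d + 1) (2 * k)) : ℝ)⁻¹ *
          (gibbsState β (hamiltonian κ U g (fun (_ _ : FermionTorus (d + 1) (2 * k)) => (0 : ℝ)) B)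
            orderParameter).re := by
  obtain ⟨β₀, hβ₀, h⟩ := thermal_spontaneousOrder_coulomb hd hg hκg le_rfl (by positivity) hU
  refine ⟨β₀, hβ₀, fun β hβ B hB => ?_⟩
  obtain ⟨k₁, hk₁⟩ := h β hβ B hB
  refine ⟨k₁, fun k hk _ => ?_⟩
  have := hk₁ k hk
  rwa [hamiltonianC_zero] at this

/-! ### Koma's own frame: the printed Hamiltonian (2.4) with (2.6) and the staggered order parameter (2.5) -/

/-- **THERMAL SPONTANEOUS SUPERCONDUCTING ORDER IN KOMA'S `π`-FLUX BCS MODEL, AS PRINTED.**  For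
`d+1 ≥ 3`, `g > 0`, `|κ| ≤ g/1000`, `0 ≤ g' ≤ g/2000` (the parameter region of the tree's Theorem 2.1) there is
`β₀ > 0` such that for every `β ≥ β₀` and EVERY symmetry-breaking field `B > 0` there is `k₁` with, on every
torus of side `2k`, `k ≥ k₁`, for Koma's Hamiltonian (2.4) (antiperiodic `π`-flux hopping (2.7)–(2.9), interaction
(2.6) with BCS pair term `g` and Coulomb repulsion `g'`, source `-B·O^{(Λ)}` with the staggered order parameter
(2.5)) and the thermal expectation (2.10):
**`|Λ|⁻¹ ⟨O^{(Λ)}⟩^{(Λ)}_{β,B} ≥ 1/50`**.  Thermal long-range order (Theorem 2.1) ⟹ spontaneous order parameter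
at positive temperature (KT93 Theorem 2.1, `m_s ≥ σ`), uniformly in `Λ` and `B > 0`.
[cite: Koma2022, (2.4)–(2.11), Theorem 2.1] [cite: KomaTasaki1993, Theorem 2.1 (2.13), (2.11); p. 211] -/
theorem printed_thermal_spontaneousOrder_coulomb (hd : 2 ≤ d) {κ g g' : ℝ} (hg : 0 < g) (hκg : |κ| ≤ g / 1000)
    (hg'0 : 0 ≤ g') (hg'g : g' ≤ g / 2000) :
    ∃ β₀ : ℝ, 0 < β₀ ∧ ∀ β : ℝ, β₀ ≤ β → ∀ B : ℝ, 0 < B →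
      ∃ k₁ : ℕ, ∀ k : ℕ, k₁ ≤ k → ∀ [NeZero (2 * k)],
        (1 / 50 : ℝ) ≤ (Fintype.card (FermionTorus (d + 1) (2 * k)) : ℝ)⁻¹ *
          (gibbsState β (printedHamiltonianC κ g g'
              (fun (_ : Fin (d + 1)) (_ : FermionTorus (d + 1) (2 * k)) => (0 : ℝ)) B) printedOrder).re := by
  have hU : (-2 * (d + 1 : ℕ) * g : ℝ) + 2 * g * (d + 1) ≤ 0 := by push_cast; linarith
  obtain ⟨β₀, hβ₀, h⟩ := thermal_spontaneousOrder_coulomb hd hg hκg hg'0 hg'g hU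
  refine ⟨β₀, hβ₀, fun β hβ B hB => ?_⟩
  obtain ⟨k₁, hk₁⟩ := h β hβ B hB
  refine ⟨max k₁ 2, fun k hk _ => ?_⟩
  have := hk₁ k (le_trans (le_max_left _ _) hk)
  rwa [gibbsState_printedOrder_eq (even_two_mul k) (by omega)]

/-- The printed edition at `g' = 0`. [cite: Koma2022, (2.4)–(2.11), Theorem 2.1] [cite: KomaTasaki1993, Theorem 2.1 (2.13)] -/
theorem printed_thermal_spontaneousOrder (hd : 2 ≤ d) {κ g : ℝ} (hg : 0 < g) (hκg : |κ| ≤ g / 1000) :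
    ∃ β₀ : ℝ, 0 < β₀ ∧ ∀ β : ℝ, β₀ ≤ β → ∀ B : ℝ, 0 < B →
      ∃ k₁ : ℕ, ∀ k : ℕ, k₁ ≤ k → ∀ [NeZero (2 * k)],
        (1 / 50 : ℝ) ≤ (Fintype.card (FermionTorus (d + 1) (2 * k)) : ℝ)⁻¹ *
          (gibbsState β (printedHamiltonian κ g
              (fun (_ : Fin (d + 1)) (_ : FermionTorus (d + 1) (2 * k)) => (0 : ℝ)) B) printedOrder).re := by
  obtain ⟨β₀, hβ₀, h⟩ := printed_thermal_spontaneousOrder_coulomb hd hg hκg le_rfl (by positivity)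
  refine ⟨β₀, hβ₀, fun β hβ B hB => ?_⟩
  obtain ⟨k₁, hk₁⟩ := h β hβ B hB
  refine ⟨k₁, fun k hk _ => ?_⟩
  have := hk₁ k hk
  rwa [printedHamiltonianC_zero] at this

/-! ### The `U(1)` factor `√2` (KT93 Remark after Theorem 6.1): floor `1/√1000`, the constant of (2.15) -/

section SqrtTwo

variable {L : ℕ}

/-- `O^{(2)} = Σ_xΓ¹_x` is Hermitian. [cite: Koma2022, (3.3)] -/
theorem isHermitian_sum_gammaOne :
    (∑ x : FermionTorus (d + 1) L, gammaOne x : Matrix (Idx d L) (Idx d L) ℂ).IsHermitian :=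
  (isSelfAdjoint_sum Finset.univ fun x _ => (gammaOne_isHermitian x).isSelfAdjoint).isHermitian

/-- `‖Σ_xΓ¹_x‖ ≤ 2|Λ|`. [cite: KomaTasaki1993, §2 ii)] -/
theorem norm_sum_gammaOne_le :
    ‖(∑ x : FermionTorus (d + 1) L, gammaOne x : Matrix (Idx d L) (Idx d L) ℂ)‖ ≤
      2 * (Fintype.card (FermionTorus (d + 1) L) : ℝ) :=
  calc ‖(∑ x : FermionTorus (d + 1) L, gammaOne x : Matrix (Idx d L) (Idx d L) ℂ)‖
      ≤ ∑ x : FermionTorus (d + 1) L, ‖(gammaOne x : Matrix (Idx d L) (Idx d L) ℂ)‖ := norm_sum_le _ _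
    _ ≤ ∑ _x : FermionTorus (d + 1) L, (2 : ℝ) := Finset.sum_le_sum fun x _ => norm_gammaOne_le x
    _ = 2 * (Fintype.card (FermionTorus (d + 1) L) : ℝ) := by
        rw [Finset.sum_const, Finset.card_univ, nsmul_eq_mul, mul_comm]

/-- v) for pairing: `[N̂/2, Σ_xΓ¹_x] = -i Σ_xΓ²_x`. [cite: KomaTasaki1994, (2.14), §3.3] [cite: Koma2022, (3.8)–(3.10)] -/
theorem halfNumber_comm_sum_gammaOne :
    ((2 : ℂ)⁻¹ • totalNumber) * (∑ x : FermionTorus (d + 1) L, gammaOne x) -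
        (∑ x : FermionTorus (d + 1) L, gammaOne x) * ((2 : ℂ)⁻¹ • totalNumber) =
      (-Complex.I) • (orderParameter : Matrix (Idx d L) (Idx d L) ℂ) := by
  have h := sum_orderDensity_one_comm_halfNumber (d := d) (L := L)
  simp only [orderDensity_one, orderDensity_zero] at h
  rw [← orderParameter] at h
  rw [← neg_sub, h, neg_smul]

/-- v) for pairing: `[N̂/2, Σ_xΓ²_x] = i Σ_xΓ¹_x = -((-i) Σ_xΓ¹_x)`. [cite: KomaTasaki1994, (2.14), §3.3] [cite: Koma2022, (3.8)–(3.10)] -/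
theorem halfNumber_comm_orderParameter :
    ((2 : ℂ)⁻¹ • totalNumber) * (orderParameter : Matrix (Idx d L) (Idx d L) ℂ) -
        orderParameter * ((2 : ℂ)⁻¹ • totalNumber) =
      -((-Complex.I) • ∑ x : FermionTorus (d + 1) L, gammaOne x) := by
  have h := sum_orderDensity_zero_comm_halfNumber (d := d) (L := L)
  simp only [orderDensity_one, orderDensity_zero] at h
  rw [← orderParameter] at h
  rw [← neg_sub, h, neg_smul, neg_neg]

/-- **The commutator bound**: `‖[Σ_xΓ¹_x, Σ_xΓ²_x]‖ ≤ 2·2²·|Λ|` (KT93 (7.22) with `ō = 2`, `κ = 2`: only the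
diagonal terms survive, hypothesis iv)) — the matrix form of the tree's `KomaTasaki.U1System.norm_orderComm_le` for
the instance `ktSystem`. [cite: KomaTasaki1993, (7.22)] [cite: KomaTasaki1994, §4] -/
theorem norm_comm_sum_gammaOne_orderParameter_le [NeZero L] (κ U g g' : ℝ) :
    ‖(∑ x : FermionTorus (d + 1) L, gammaOne x) * (orderParameter : Matrix (Idx d L) (Idx d L) ℂ) -
        orderParameter * (∑ x : FermionTorus (d + 1) L, gammaOne x)‖ ≤
      2 * 2 ^ 2 * (Fintype.card (FermionTorus (d + 1) L) : ℝ) := by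
  have h := (ktSystem (d := d) (L := L) κ U g g').norm_orderComm_le
  rw [KomaTasaki.U1System.orderComm, ktSystem_order_zero, ktSystem_order_one, ktSystem_obar, ← map_mul, ← map_mul,
    ← map_sub, Matrix.l2_opNorm_toEuclideanCLM, ← norm_neg, neg_sub] at h
  exact h

/-- **ENGINE WITH THE `U(1)` FACTOR `√2` (Lieb frame, every `β > 0`).**  If `a ≤ lroSq β H(κ,U;g,g';0;0)`
(`0 ≤ a`) on every torus `(ℤ/2kℤ)^{d+1}` with `k ≥ k₀`, then for every `B > 0`, `ε > 0` there is `k₁` with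
`√(2a) - ε ≤ |Λ|⁻¹ Re⟨Σ_xΓ²_x⟩_{β, H(κ,U;g,g';0;B)}` for all `k ≥ k₁` — KT93 Corollary 2.2 for the `SO(2) = U(1)`
symmetry generated by `N̂/2` (hypothesis i) removed), for `KomaPiFlux.z2System` with `O^{(2)} = Σ_xΓ¹_x`.
[cite: KomaTasaki1993, Corollary 2.2 (2.18) with Remark after Theorem 6.1 (U(1): factor √2)] [cite: Koma2022, (2.10)–(2.11), (3.8)–(3.10)] -/
theorem thermal_orderParameter_ge_of_lroSq_sqrtTwo {κ U g g' β a : ℝ} (hβ : 0 < β) (ha : 0 ≤ a) {k₀ : ℕ}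
    (hLRO : ∀ k : ℕ, k₀ ≤ k → ∀ [NeZero (2 * k)],
      a ≤ lroSq β (hamiltonianC κ U g g' (fun (_ _ : FermionTorus (d + 1) (2 * k)) => (0 : ℝ)) 0))
    {B : ℝ} (hB : 0 < B) {ε : ℝ} (hε : 0 < ε) :
    ∃ k₁ : ℕ, ∀ k : ℕ, k₁ ≤ k → ∀ [NeZero (2 * k)],
      Real.sqrt (2 * a) - ε ≤ (Fintype.card (FermionTorus (d + 1) (2 * k)) : ℝ)⁻¹ *
        (gibbsState β (hamiltonianC κ U g g' (fun (_ _ : FermionTorus (d + 1) (2 * k)) => (0 : ℝ)) B)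
          orderParameter).re := by
  have hne : ∀ j : ℕ, NeZero (2 * (j + 1)) := fun j => ⟨by omega⟩
  let sys : (j : ℕ) → KomaTasaki.Z2System (Fintype.card (FermionTorus (d + 1) (2 * (j + 1))))
      (hbarConst d κ U g g') 2 (2 * (d + 1) + 1) (Idx d (2 * (j + 1))) :=
    fun j => @z2System d (2 * (j + 1)) (hne j) κ U g g'
  let O₂ : (j : ℕ) → Matrix (Idx d (2 * (j + 1))) (Idx d (2 * (j + 1))) ℂ :=
    fun j => ∑ x : FermionTorus (d + 1) (2 * (j + 1)), gammaOne x
  let C : (j : ℕ) → Matrix (Idx d (2 * (j + 1))) (Idx d (2 * (j + 1))) ℂ :=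
    fun j => (2 : ℂ)⁻¹ • totalNumber
  have hN : Tendsto (fun j : ℕ => Fintype.card (FermionTorus (d + 1) (2 * (j + 1)))) atTop atTop :=
    tendsto_card_fermionTorus_two_mul.comp (tendsto_add_atTop_nat 1)
  have hdim : ∀ j : ℕ, Real.log (Fintype.card (Idx d (2 * (j + 1)))) ≤
      2 * (Fintype.card (FermionTorus (d + 1) (2 * (j + 1))) : ℝ) := fun j => log_card_idx_le
  have hLRO' : ∀ᶠ j : ℕ in atTop, (Real.sqrt a) ^ 2 ≤ (sys j).moment β 1 := by
    filter_upwards [eventually_ge_atTop k₀] with j hj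
    rw [Real.sq_sqrt ha, @z2System_moment_one d (2 * (j + 1)) (hne j)]
    exact @hLRO (j + 1) (by omega) (hne j)
  have hC : ∀ j, Commute (sys j).hamiltonian (C j) := fun j => by
    rw [@z2System_hamiltonian d (2 * (j + 1)) (hne j)]
    exact (PairHopRP.commute_totalNumber_hamiltonianC_zero (G d (2 * (j + 1))) (piFluxAmpl κ) U g g').symm.smul_right _
  have hrot₁ : ∀ j, C j * O₂ j - O₂ j * C j = (-Complex.I) • (sys j).order := fun j => by
    rw [@z2System_order d (2 * (j + 1)) (hne j)]
    exact halfNumber_comm_sum_gammaOne (d := d) (L := 2 * (j + 1))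
  have hrot₂ : ∀ j, C j * (sys j).order - (sys j).order * C j = -((-Complex.I) • O₂ j) := fun j => by
    rw [@z2System_order d (2 * (j + 1)) (hne j)]
    exact halfNumber_comm_orderParameter (d := d) (L := 2 * (j + 1))
  have hO₂ : ∀ j, ‖O₂ j‖ ≤ 2 * (Fintype.card (FermionTorus (d + 1) (2 * (j + 1))) : ℝ) := fun j =>
    norm_sum_gammaOne_le (d := d) (L := 2 * (j + 1))
  have hκ : ∀ j, ‖O₂ j * (sys j).order - (sys j).order * O₂ j‖ ≤
      2 * 2 ^ 2 * (Fintype.card (FermionTorus (d + 1) (2 * (j + 1))) : ℝ) := fun j => by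
    rw [@z2System_order d (2 * (j + 1)) (hne j)]
    exact @norm_comm_sum_gammaOne_orderParameter_le d (2 * (j + 1)) (hne j) κ U g g'
  have hev := KomaTasaki.Z2System.le_sqrt_two_mul_magnetisation_add_of_eventually_moment_one_u1 sys O₂ C
    (neg_ne_zero.2 Complex.I_ne_zero) (by norm_num : (0 : ℝ) ≤ 2)
    (fun j => isHermitian_sum_gammaOne (d := d) (L := 2 * (j + 1))) hC hrot₁ hrot₂ hO₂ hκ
    (by norm_num : (0 : ℝ) ≤ 2) hβ hN hdim (Real.sqrt_nonneg a) hLRO' hB hε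
  obtain ⟨j₁, hj₁⟩ := eventually_atTop.1 hev
  refine ⟨j₁ + 1, fun k hk inst => ?_⟩
  obtain ⟨j, rfl⟩ : ∃ j, k = j + 1 := ⟨k - 1, by omega⟩
  have h := hj₁ j (by omega)
  rw [@z2System_magnetisation d (2 * (j + 1)) (hne j), ← Real.sqrt_mul' 2 ha] at h
  have hinst : inst = hne j := rfl
  subst hinst
  linarith

/-- `3/100 < 1/√1000` (`ε`-absorption for the `√2`-sharp floor). [cite: Koma2022, (2.15)] -/
theorem three_div_hundred_lt_sqrt : (3 / 100 : ℝ) < Real.sqrt (2 * (1 / 2000)) := by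
  rw [show (3 / 100 : ℝ) = Real.sqrt ((3 / 100) ^ 2) by rw [Real.sqrt_sq (by norm_num)]]
  exact Real.sqrt_lt_sqrt (by norm_num) (by norm_num)

/-- **THERMAL SPONTANEOUS SUPERCONDUCTING ORDER WITH THE `U(1)` FACTOR `√2`, `ε`-form (Lieb frame)**: for
`D = d+1 ≥ 3`, `g > 0`, `|κ| ≤ g/1000`, `0 ≤ g' ≤ g/2000`, `U + 2gD ≤ 0`, `β ≥ β₀`, every `B > 0`, `ε > 0`:
eventually on the even tori `1/√1000 - ε ≤ |Λ|⁻¹ Re⟨Σ_xΓ²_x⟩_{β, H(B)}` (`√(2σ²)`, `σ² = 1/2000`: the constant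
`μ = 1/√1000` of the tree's zero-temperature (2.15), `spontaneousOrder_coulomb`).
[cite: Koma2022, Theorem 2.1, (2.15)] [cite: KomaTasaki1993, Corollary 2.2 (2.18) with Remark after Theorem 6.1] -/
theorem thermal_spontaneousOrder_coulomb_sqrtTwo (hd : 2 ≤ d) {κ U g g' : ℝ} (hg : 0 < g) (hκg : |κ| ≤ g / 1000)
    (hg'0 : 0 ≤ g') (hg'g : g' ≤ g / 2000) (hU : U + 2 * g * (d + 1) ≤ 0) :
    ∃ β₀ : ℝ, 0 < β₀ ∧ ∀ β : ℝ, β₀ ≤ β → ∀ B : ℝ, 0 < B → ∀ ε : ℝ, 0 < ε →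
      ∃ k₁ : ℕ, ∀ k : ℕ, k₁ ≤ k → ∀ [NeZero (2 * k)],
        1 / Real.sqrt 1000 - ε ≤ (Fintype.card (FermionTorus (d + 1) (2 * k)) : ℝ)⁻¹ *
          (gibbsState β (hamiltonianC κ U g g' (fun (_ _ : FermionTorus (d + 1) (2 * k)) => (0 : ℝ)) B)
            orderParameter).re := by
  obtain ⟨β₀, k₀, hβ₀, h⟩ := superconductingOrder_coulomb_abs hd hg hκg hg'0 hg'g hU
  refine ⟨β₀, hβ₀, fun β hβ B hB ε hε => ?_⟩
  rw [← sqrt_two_div_two_thousand]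
  exact thermal_orderParameter_ge_of_lroSq_sqrtTwo (lt_of_lt_of_le hβ₀ hβ) (by norm_num)
    (fun k hk _ => h β hβ k hk) hB hε

/-- **THERMAL SPONTANEOUS SUPERCONDUCTING ORDER, `√2`-SHARP, `ε`-FREE (Lieb frame)**: under the same hypotheses,
for `β ≥ β₀` and every `B > 0`, eventually on the even tori **`3/100 ≤ |Λ|⁻¹ Re⟨Σ_xΓ²_x⟩_{β, H(B)}`**.
[cite: Koma2022, Theorem 2.1, (2.15)] [cite: KomaTasaki1993, Corollary 2.2 (2.18) with Remark after Theorem 6.1] -/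
theorem thermal_spontaneousOrder_coulomb_sharp (hd : 2 ≤ d) {κ U g g' : ℝ} (hg : 0 < g) (hκg : |κ| ≤ g / 1000)
    (hg'0 : 0 ≤ g') (hg'g : g' ≤ g / 2000) (hU : U + 2 * g * (d + 1) ≤ 0) :
    ∃ β₀ : ℝ, 0 < β₀ ∧ ∀ β : ℝ, β₀ ≤ β → ∀ B : ℝ, 0 < B →
      ∃ k₁ : ℕ, ∀ k : ℕ, k₁ ≤ k → ∀ [NeZero (2 * k)],
        (3 / 100 : ℝ) ≤ (Fintype.card (FermionTorus (d + 1) (2 * k)) : ℝ)⁻¹ *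
          (gibbsState β (hamiltonianC κ U g g' (fun (_ _ : FermionTorus (d + 1) (2 * k)) => (0 : ℝ)) B)
            orderParameter).re := by
  obtain ⟨β₀, k₀, hβ₀, h⟩ := superconductingOrder_coulomb_abs hd hg hκg hg'0 hg'g hU
  refine ⟨β₀, hβ₀, fun β hβ B hB => ?_⟩
  obtain ⟨k₁, hk₁⟩ := thermal_orderParameter_ge_of_lroSq_sqrtTwo (d := d) (lt_of_lt_of_le hβ₀ hβ)
    (by norm_num : (0 : ℝ) ≤ 1 / 2000) (fun k hk _ => h β hβ k hk) hB
    (sub_pos.2 three_div_hundred_lt_sqrt)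
  exact ⟨k₁, fun k hk _ => by have := hk₁ k hk; linarith⟩

/-- **THE `√2`-SHARP FLOOR IN KOMA'S OWN FRAME**: for `d+1 ≥ 3`, `g > 0`, `|κ| ≤ g/1000`, `0 ≤ g' ≤ g/2000`,
`β ≥ β₀`, every `B > 0`: eventually on the tori of side `2k`, **`|Λ|⁻¹⟨O^{(Λ)}⟩^{(Λ)}_{β,B} ≥ 3/100`** for the
printed Hamiltonian (2.4) with (2.6)–(2.9) and the staggered order parameter (2.5).
[cite: Koma2022, (2.4)–(2.11), Theorem 2.1, (2.15)] [cite: KomaTasaki1993, Corollary 2.2 (2.18) with Remark after Theorem 6.1; p. 211] -/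
theorem printed_thermal_spontaneousOrder_coulomb_sharp (hd : 2 ≤ d) {κ g g' : ℝ} (hg : 0 < g)
    (hκg : |κ| ≤ g / 1000) (hg'0 : 0 ≤ g') (hg'g : g' ≤ g / 2000) :
    ∃ β₀ : ℝ, 0 < β₀ ∧ ∀ β : ℝ, β₀ ≤ β → ∀ B : ℝ, 0 < B →
      ∃ k₁ : ℕ, ∀ k : ℕ, k₁ ≤ k → ∀ [NeZero (2 * k)],
        (3 / 100 : ℝ) ≤ (Fintype.card (FermionTorus (d + 1) (2 * k)) : ℝ)⁻¹ *
          (gibbsState β (printedHamiltonianC κ g g'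
              (fun (_ : Fin (d + 1)) (_ : FermionTorus (d + 1) (2 * k)) => (0 : ℝ)) B) printedOrder).re := by
  have hU : (-2 * (d + 1 : ℕ) * g : ℝ) + 2 * g * (d + 1) ≤ 0 := by push_cast; linarith
  obtain ⟨β₀, hβ₀, h⟩ := thermal_spontaneousOrder_coulomb_sharp hd hg hκg hg'0 hg'g hU
  refine ⟨β₀, hβ₀, fun β hβ B hB => ?_⟩
  obtain ⟨k₁, hk₁⟩ := h β hβ B hB
  refine ⟨max k₁ 2, fun k hk _ => ?_⟩
  have := hk₁ k (le_trans (le_max_left _ _) hk)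
  rwa [gibbsState_printedOrder_eq (even_two_mul k) (by omega)]

end SqrtTwo

/-! ### Eventual (`Filter`) spellings -/

/-- `liminf` form: for `β ≥ β₀` and every `B > 0`, eventually along the even tori
`1/50 ≤ |Λ|⁻¹ Re⟨Σ_xΓ²_x⟩_{β,B}` (Lieb frame). [cite: Koma2022, Theorem 2.1] [cite: KomaTasaki1993, Theorem 2.1 (2.13), (2.11)] -/
theorem thermal_spontaneousOrder_coulomb_eventually (hd : 2 ≤ d) {κ U g g' : ℝ} (hg : 0 < g)
    (hκg : |κ| ≤ g / 1000) (hg'0 : 0 ≤ g') (hg'g : g' ≤ g / 2000) (hU : U + 2 * g * (d + 1) ≤ 0) :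
    ∃ β₀ : ℝ, 0 < β₀ ∧ ∀ β : ℝ, β₀ ≤ β → ∀ B : ℝ, 0 < B → ∀ᶠ k : ℕ in atTop, ∀ [NeZero (2 * k)],
      (1 / 50 : ℝ) ≤ (Fintype.card (FermionTorus (d + 1) (2 * k)) : ℝ)⁻¹ *
        (gibbsState β (hamiltonianC κ U g g' (fun (_ _ : FermionTorus (d + 1) (2 * k)) => (0 : ℝ)) B)
          orderParameter).re := by
  obtain ⟨β₀, hβ₀, h⟩ := thermal_spontaneousOrder_coulomb hd hg hκg hg'0 hg'g hU
  refine ⟨β₀, hβ₀, fun β hβ B hB => ?_⟩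
  obtain ⟨k₁, hk₁⟩ := h β hβ B hB
  exact (eventually_ge_atTop k₁).mono fun k hk => hk₁ k hk

end KomaPiFlux

end Literature.MathematicalPhysics.QuantumLattice
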